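import Summits.MatrixMultiplication.MatrixMultiplication.Theorems.SoloInformedOrbitRankGen
import HarnessLib

/-!
# Door-like supports: the two-leg annihilator of every Kronecker power is a line

Solo programme `solo-MatrixMultiplication-informed`, generation 28, §2o(7) of the sharpest
statement (the converse door at EVERY finite level over EVERY field).

`OrbitRankGen.orbitForm T` is the `|ι|³ × 2|ι|²` matrix of `(X, Y) ↦ X·₁T + Y·₂T`; its kernel is
the two-leg annihilator `𝔞(T) = {(X, Y) : X·₁T + Y·₂T = 0}`, which always contains `(1, -1)`.

* `DoorLike T` — six finite conditions on the SUPPORT of `T` (each `(b,c)` is hit by at most one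
  `a`, each `(a,c)` by at most one `b`; off-diagonal entries of `X`, `Y` can be isolated; the
  support is connected).  They hold for `T_{cw,2}`, `T_{skewcw,2}`, `P`, `ε` (decided on
  `{0,1,2}` in `SoloInformedConverseDoorAllLevels`) and fail for `⟨n⟩` and `⟨m,m,m⟩`.
* `DoorLike.kroneckerPow` — door-likeness is inherited by every Kronecker power `T^{⊠N}`
  (coordinatewise choices; a field has no zero divisors).
* `DoorLike.apply_eq`, `DoorLike.le_rank` — for a door-like `T` over a field the annihilator is
  the line `K·(1,-1)`, so `rank O_T ≥ 2|ι|² - 1` (rank–nullity).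
* `rank_orbitForm_matMul_le` — for `⟨m,m,m⟩` the annihilator contains the `m²` pairs
  `(E ⊗ 1, -(Eᵀ ⊗ 1))`, `E ∈ gl_m` (the `GL_m` acting between the output and the first input), so
  `rank O_{⟨m,m,m⟩} ≤ 2m⁴ - m²`.
Together (next file): `⟨m,m,m⟩ ⋭ T^{⊠N}` whenever `m² = 3^N`, `m ≥ 2`, over every field — the
matrix-multiplication orbit is too small in every characteristic, by an argument that needs no
Lie theory.  Sources: the orbit map and its use [cite: ConnerGesmundoLandsbergVentura2022, §3.2];
degenerations [cite: Alman2021, §2.4].  Everything here is PROVED; no new axioms.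
-/

namespace Summit.MatrixMultiplication.MatrixMultiplication.Theorems

open Matrix Finset Module
open Literature.Computability.AlgebraicComplexity

universe u

set_option linter.unusedSectionVars false

namespace OrbitRankGen

variable {ι : Type} [Fintype ι] [DecidableEq ι]

/-! ## Door-like supports -/

section DoorLike

/-- **Door-like support** of a tensor `T ∈ R^ι ⊗ R^ι ⊗ R^ι` (conditions on `{T ≠ 0}` only):
uniqueness of the first (second) index given the other two, isolation of off-diagonal entries of
`X` (`Y`), and connectivity of the support through the second index — the abstract form of
the support of `T_{cw,2}`, `T_{skewcw,2}`, `P` used in CGLV's stabiliser computations (a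
proof-carrying record; its inhabitants are built by `decide` on `{0,1,2}` and propagated to
Kronecker powers). [cite: ConnerGesmundoLandsbergVentura2022, §3.2] -/
structure DoorLike {R : Type*} [Zero R] (T : ι → ι → ι → R) : Type where
  uniq₁ : ∀ b c q q', T q b c ≠ 0 → T q' b c ≠ 0 → q = q'
  uniq₂ : ∀ a c q q', T a q c ≠ 0 → T a q' c ≠ 0 → q = q'
  kill₁ : ∀ a a', a ≠ a' → ∃ b c, T a' b c ≠ 0 ∧ ∀ q, T a q c = 0
  kill₂ : ∀ b b', b ≠ b' → ∃ a c, T a b' c ≠ 0 ∧ ∀ q, T q b c = 0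
  link₁ : ∀ a a', ∃ b c c', T a b c ≠ 0 ∧ T a' b c' ≠ 0
  link₂ : ∀ b, ∃ a c, T a b c ≠ 0

variable {F : Type u} [Field F]

/-- Door-likeness of an integer tensor with entries in `{0, 1, -1}` survives reading it in any
field (of any characteristic).  (`DoorLike` is proof-carrying data, whence `def`.) [folklore] -/
noncomputable def DoorLike.intCast {tZ : ι → ι → ι → ℤ} (h : DoorLike tZ)
    (hu : ∀ a b c, tZ a b c = 0 ∨ tZ a b c = 1 ∨ tZ a b c = -1) :
    DoorLike (fun a b c => (tZ a b c : F)) := by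
  have hiff : ∀ a b c, ((tZ a b c : F) ≠ 0 ↔ tZ a b c ≠ 0) := fun a b c => by
    rcases hu a b c with h | h | h <;> simp [h]
  refine ⟨fun b c q q' hq hq' => h.uniq₁ b c q q' ((hiff _ _ _).1 hq) ((hiff _ _ _).1 hq'),
    fun a c q q' hq hq' => h.uniq₂ a c q q' ((hiff _ _ _).1 hq) ((hiff _ _ _).1 hq'),
    fun a a' hne => ?_, fun b b' hne => ?_, fun a a' => ?_, fun b => ?_⟩
  · obtain ⟨b, c, h1, h2⟩ := h.kill₁ a a' hne
    exact ⟨b, c, (hiff _ _ _).2 h1, fun q => by simp [h2 q]⟩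
  · obtain ⟨a, c, h1, h2⟩ := h.kill₂ b b' hne
    exact ⟨a, c, (hiff _ _ _).2 h1, fun q => by simp [h2 q]⟩
  · obtain ⟨b, c, c', h1, h2⟩ := h.link₁ a a'
    exact ⟨b, c, c', (hiff _ _ _).2 h1, (hiff _ _ _).2 h2⟩
  · obtain ⟨a, c, h1⟩ := h.link₂ b
    exact ⟨a, c, (hiff _ _ _).2 h1⟩

/-- **Kronecker powers of a door-like tensor are door-like** (coordinatewise witnesses; a product
of non-zero field elements is non-zero, a product with a zero factor vanishes).
[cite: ConnerGesmundoLandsbergVentura2022, §3.1] -/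
noncomputable def DoorLike.kroneckerPow {t : ι → ι → ι → F} (ht : DoorLike t) (N : ℕ) :
    DoorLike (kroneckerPow t N) := by
  classical
  choose fb fc fc' hf using ht.link₁
  choose ga gc hg using ht.link₂
  refine ⟨?_, ?_, ?_, ?_, ?_, ?_⟩
  · intro b c q q' hq hq'
    rw [kroneckerPow_apply, Finset.prod_ne_zero_iff] at hq hq'
    funext i
    exact ht.uniq₁ _ _ _ _ (hq i (Finset.mem_univ _)) (hq' i (Finset.mem_univ _))
  · intro a c q q' hq hq'
    rw [kroneckerPow_apply, Finset.prod_ne_zero_iff] at hq hq'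
    funext i
    exact ht.uniq₂ _ _ _ _ (hq i (Finset.mem_univ _)) (hq' i (Finset.mem_univ _))
  · intro a a' hne
    obtain ⟨i, hi⟩ := Function.ne_iff.1 hne
    obtain ⟨bi, ci, h1, h2⟩ := ht.kill₁ _ _ hi
    refine ⟨fun j => if j = i then bi else fb (a' j) (a' j),
      fun j => if j = i then ci else fc (a' j) (a' j), ?_, fun q => ?_⟩
    · rw [kroneckerPow_apply, Finset.prod_ne_zero_iff]
      intro j _
      by_cases hj : j = i
      · subst hj; simpa using h1
      · simp only [if_neg hj]; exact (hf (a' j) (a' j)).1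
    · rw [kroneckerPow_apply]
      exact Finset.prod_eq_zero (Finset.mem_univ i) (by simpa using h2 (q i))
  · intro b b' hne
    obtain ⟨i, hi⟩ := Function.ne_iff.1 hne
    obtain ⟨ai, ci, h1, h2⟩ := ht.kill₂ _ _ hi
    refine ⟨fun j => if j = i then ai else ga (b' j),
      fun j => if j = i then ci else gc (b' j), ?_, fun q => ?_⟩
    · rw [kroneckerPow_apply, Finset.prod_ne_zero_iff]
      intro j _
      by_cases hj : j = i
      · subst hj; simpa using h1
      · simp only [if_neg hj]; exact hg (b' j)
    · rw [kroneckerPow_apply]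
      exact Finset.prod_eq_zero (Finset.mem_univ i) (by simpa using h2 (q i))
  · intro a a'
    refine ⟨fun j => fb (a j) (a' j), fun j => fc (a j) (a' j), fun j => fc' (a j) (a' j), ?_, ?_⟩
    · rw [kroneckerPow_apply, Finset.prod_ne_zero_iff]
      exact fun j _ => (hf (a j) (a' j)).1
    · rw [kroneckerPow_apply, Finset.prod_ne_zero_iff]
      exact fun j _ => (hf (a j) (a' j)).2
  · intro b
    refine ⟨fun j => ga (b j), fun j => gc (b j), ?_⟩
    rw [kroneckerPow_apply, Finset.prod_ne_zero_iff]
    exact fun j _ => hg (b j)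

/-! ## The annihilator of a door-like tensor -/

/-- The two-leg action read off `O_T`: `(O_T v)_{abc} = Σ_q T_{qbc} X_{aq} + Σ_q T_{aqc} Y_{bq}`
with `X_{aq} = v (0,a,q)`, `Y_{bq} = v (1,b,q)`. [folklore] -/
theorem orbitForm_mulVec (T : ι → ι → ι → F) (v : Col ι → F) (a b c : ι) :
    (orbitForm T *ᵥ v) (a, b, c) =
      ∑ q, T q b c * v (0, a, q) + ∑ q, T a q c * v (1, b, q) := by
  have h10 : (1 : Fin 2) ≠ 0 := by decide
  simp only [Matrix.mulVec, dotProduct, orbitForm_apply, ite_mul, zero_mul]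
  rw [Fintype.sum_prod_type, Fin.sum_univ_two]
  simp only [if_true, if_neg h10]
  congr 1
  · rw [Fintype.sum_prod_type, Finset.sum_comm]
    simp only [Finset.sum_ite_eq, Finset.mem_univ, if_true]
  · rw [Fintype.sum_prod_type, Finset.sum_comm]
    simp only [Finset.sum_ite_eq, Finset.mem_univ, if_true]

/-- The flattened pair `(1, -1) ∈ gl ⊕ gl` — the annihilator every tensor has. [folklore] -/
def doorVec : Col ι → F := fun w => if w.2.1 = w.2.2 then (if w.1 = 0 then 1 else -1) else 0

/-- **The annihilator of a door-like tensor is the line `K·(1,-1)`**: every `(X, Y)` with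
`X·₁T + Y·₂T = 0` has `X`, `Y` diagonal, `X` scalar and `Y = -X`. [folklore] -/
theorem DoorLike.apply_eq {T : ι → ι → ι → F} (hT : DoorLike T) {v : Col ι → F}
    (hv : orbitForm T *ᵥ v = 0) (a₀ : ι) : v = v (0, a₀, a₀) • (doorVec : Col ι → F) := by
  have h10 : (1 : Fin 2) ≠ 0 := by decide
  have E : ∀ a b c, ∑ q, T q b c * v (0, a, q) + ∑ q, T a q c * v (1, b, q) = 0 :=
    fun a b c => by rw [← orbitForm_mulVec, hv]; rfl
  have S1 : ∀ a b c a', T a' b c ≠ 0 →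
      ∑ q, T q b c * v (0, a, q) = T a' b c * v (0, a, a') := by
    intro a b c a' h
    refine Finset.sum_eq_single a' (fun q _ hq => ?_) (fun h' => absurd (Finset.mem_univ _) h')
    rw [show T q b c = 0 from by_contra fun h' => hq (hT.uniq₁ b c q a' h' h), zero_mul]
  have Z1 : ∀ a b c, (∀ q, T q b c = 0) → ∑ q, T q b c * v (0, a, q) = 0 :=
    fun a b c h => Finset.sum_eq_zero fun q _ => by rw [h q, zero_mul]
  have S2 : ∀ a b c b', T a b' c ≠ 0 →
      ∑ q, T a q c * v (1, b, q) = T a b' c * v (1, b, b') := by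
    intro a b c b' h
    refine Finset.sum_eq_single b' (fun q _ hq => ?_) (fun h' => absurd (Finset.mem_univ _) h')
    rw [show T a q c = 0 from by_contra fun h' => hq (hT.uniq₂ a c q b' h' h), zero_mul]
  have Z2 : ∀ a b c, (∀ q, T a q c = 0) → ∑ q, T a q c * v (1, b, q) = 0 :=
    fun a b c h => Finset.sum_eq_zero fun q _ => by rw [h q, zero_mul]
  have hX : ∀ a a', a ≠ a' → v (0, a, a') = 0 := by
    intro a a' hne
    obtain ⟨b, c, h1, h2⟩ := hT.kill₁ a a' hne
    have e := E a b c
    rw [S1 a b c a' h1, Z2 a b c h2, add_zero] at e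
    exact (mul_eq_zero.1 e).resolve_left h1
  have hY : ∀ b b', b ≠ b' → v (1, b, b') = 0 := by
    intro b b' hne
    obtain ⟨a, c, h1, h2⟩ := hT.kill₂ b b' hne
    have e := E a b c
    rw [Z1 a b c h2, zero_add, S2 a b c b' h1] at e
    exact (mul_eq_zero.1 e).resolve_left h1
  have hD : ∀ a b c, T a b c ≠ 0 → v (0, a, a) + v (1, b, b) = 0 := by
    intro a b c h
    have e := E a b c
    rw [S1 a b c a h, S2 a b c b h, ← mul_add] at e
    exact (mul_eq_zero.1 e).resolve_left h
  have hXX : ∀ a, v (0, a, a) = v (0, a₀, a₀) := by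
    intro a
    obtain ⟨b, c, c', h1, h2⟩ := hT.link₁ a a₀
    linear_combination hD a b c h1 - hD a₀ b c' h2
  have hYY : ∀ b, v (1, b, b) = -v (0, a₀, a₀) := by
    intro b
    obtain ⟨a, c, h⟩ := hT.link₂ b
    linear_combination hD a b c h - hXX a
  funext w
  obtain ⟨f, p, q⟩ := w
  simp only [doorVec, Pi.smul_apply, smul_eq_mul]
  by_cases hpq : p = q
  · subst hpq
    fin_cases f
    · simp [hXX p]
    · simp [h10, hYY p]
  · fin_cases f
    · simp [hpq, hX p q hpq]
    · simp [hpq, hY p q hpq]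

/-- **Rank bound for door-like tensors**: `rank O_T ≥ 2|ι|² - 1` over every field
(rank–nullity; the kernel of `O_T` is at most the line `K·(1,-1)`). [folklore] -/
theorem DoorLike.le_rank {T : ι → ι → ι → F} (hT : DoorLike T) :
    2 * (Fintype.card ι * Fintype.card ι) - 1 ≤ (orbitForm T).rank := by
  rcases isEmpty_or_nonempty ι with hι | ⟨⟨a₀⟩⟩
  · simp
  have hker : LinearMap.ker (orbitForm T).mulVecLin ≤ F ∙ (doorVec : Col ι → F) := by
    intro v hv
    rw [LinearMap.mem_ker, Matrix.mulVecLin_apply] at hv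
    rw [Submodule.mem_span_singleton]
    exact ⟨v (0, a₀, a₀), (hT.apply_eq hv a₀).symm⟩
  have h1 : finrank F (LinearMap.ker (orbitForm T).mulVecLin) ≤ 1 :=
    (Submodule.finrank_mono hker).trans
      (by simpa using finrank_span_le_card ({(doorVec : Col ι → F)} : Set (Col ι → F)))
  have hrn := LinearMap.finrank_range_add_finrank_ker (orbitForm T).mulVecLin
  rw [finrank_fintype_fun_eq_card] at hrn
  have hc : Fintype.card (Col ι) = 2 * (Fintype.card ι * Fintype.card ι) := by
    simp [Col, Fintype.card_prod]
  unfold Matrix.rank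
  omega

end DoorLike

/-! ## The annihilator of matrix multiplication contains `gl_m` -/

section MatMul

variable {F : Type u} [Field F]

/-- The flattened pair `(E ⊗ 1, -(Eᵀ ⊗ 1))` for `E ∈ gl_m`: `GL_m` acting on the row index of the
output `Z = XY` and of the first input `X` stabilises `⟨m,m,m⟩`. [cite: Blaser2013, §5] -/
def mmKerVec (m : ℕ) (E : Fin m × Fin m → F) : Col (Fin m × Fin m) → F := fun w =>
  if w.2.1.2 = w.2.2.2 then (if w.1 = 0 then E (w.2.1.1, w.2.2.1) else -E (w.2.2.1, w.2.1.1))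
  else 0

/-- `E ↦ (E ⊗ 1, -(Eᵀ ⊗ 1))` as a linear map. [folklore] -/
def mmKerMap (m : ℕ) : (Fin m × Fin m → F) →ₗ[F] (Col (Fin m × Fin m) → F) where
  toFun := mmKerVec m
  map_add' E E' := by
    funext w
    simp only [mmKerVec, Pi.add_apply]
    split_ifs <;> ring
  map_smul' c E := by
    funext w
    simp only [mmKerVec, Pi.smul_apply, smul_eq_mul, RingHom.id_apply]
    split_ifs <;> ring

/-- `E ↦ (E ⊗ 1, -(Eᵀ ⊗ 1))` is injective once `m ≥ 1`. [folklore] -/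
theorem mmKerMap_injective {m : ℕ} (hm : 0 < m) : Function.Injective (mmKerMap (F := F) m) := by
  intro E E' h
  funext ⟨κ, κ'⟩
  have := congrFun h (0, (κ, ⟨0, hm⟩), (κ', ⟨0, hm⟩))
  simpa [mmKerMap, mmKerVec] using this

/-- The pairs `(E ⊗ 1, -(Eᵀ ⊗ 1))` annihilate `⟨m,m,m⟩`:
`(E ⊗ 1)·₁⟨m,m,m⟩ = (Eᵀ ⊗ 1)·₂⟨m,m,m⟩`. [cite: Blaser2013, §5] -/
theorem orbitForm_matMul_mulVec_mmKerVec (m : ℕ) (E : Fin m × Fin m → F) :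
    orbitForm (matMulTensor F m m m) *ᵥ mmKerVec m E = 0 := by
  have h10 : (1 : Fin 2) ≠ 0 := by decide
  funext v
  obtain ⟨a, b, c⟩ := v
  rw [orbitForm_mulVec, Pi.zero_apply]
  have e1 : ∑ q, matMulTensor F m m m q b c * mmKerVec m E (0, a, q) =
      if b.2 = c.1 ∧ a.2 = c.2 then E (a.1, b.1) else 0 := by
    rw [Finset.sum_eq_single (b.1, c.2)]
    · simp only [matMulTensor, mmKerVec, true_and, and_true, if_true]
      by_cases h : b.2 = c.1 <;> by_cases h' : a.2 = c.2 <;> simp [h, h']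
    · intro q _ hq
      have : ¬ (q.1 = b.1 ∧ b.2 = c.1 ∧ q.2 = c.2) := fun h => hq (Prod.ext h.1 h.2.2)
      simp [matMulTensor, this]
    · exact fun h => absurd (Finset.mem_univ _) h
  have e2 : ∑ q, matMulTensor F m m m a q c * mmKerVec m E (1, b, q) =
      if b.2 = c.1 ∧ a.2 = c.2 then -E (a.1, b.1) else 0 := by
    rw [Finset.sum_eq_single (a.1, c.1)]
    · simp only [matMulTensor, mmKerVec, true_and, if_neg h10]
      by_cases h : b.2 = c.1 <;> by_cases h' : a.2 = c.2 <;> simp [h, h']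
    · intro q _ hq
      have : ¬ (a.1 = q.1 ∧ q.2 = c.1 ∧ a.2 = c.2) := fun h => hq (Prod.ext h.1.symm h.2.1)
      simp [matMulTensor, this]
    · exact fun h => absurd (Finset.mem_univ _) h
  rw [e1, e2]
  split_ifs <;> ring

/-- **`rank O_{⟨m,m,m⟩} ≤ 2m⁴ - m²`** over every field: the two-leg annihilator of `⟨m,m,m⟩`
contains the `m²`-dimensional space `{(E ⊗ 1, -(Eᵀ ⊗ 1))}`. [cite: Blaser2013, §5] -/
theorem rank_orbitForm_matMul_le (m : ℕ) :
    (orbitForm (matMulTensor F m m m)).rank ≤ 2 * ((m * m) * (m * m)) - m * m := by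
  rcases Nat.eq_zero_or_pos m with rfl | hm
  · exact (Matrix.rank_le_card_width _).trans (by simp)
  have hsub : LinearMap.range (mmKerMap (F := F) m) ≤
      LinearMap.ker (orbitForm (matMulTensor F m m m)).mulVecLin := by
    rintro _ ⟨E, rfl⟩
    rw [LinearMap.mem_ker, Matrix.mulVecLin_apply]
    exact orbitForm_matMul_mulVec_mmKerVec m E
  have hE : finrank F (LinearMap.range (mmKerMap (F := F) m)) = m * m := by
    rw [LinearMap.finrank_range_of_inj (mmKerMap_injective hm), finrank_fintype_fun_eq_card]
    simp
  have hk : m * m ≤ finrank F (LinearMap.ker (orbitForm (matMulTensor F m m m)).mulVecLin) :=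
    hE ▸ Submodule.finrank_mono hsub
  have hrn := LinearMap.finrank_range_add_finrank_ker (orbitForm (matMulTensor F m m m)).mulVecLin
  rw [finrank_fintype_fun_eq_card] at hrn
  have hc : Fintype.card (Col (Fin m × Fin m)) = 2 * ((m * m) * (m * m)) := by
    simp [Col, Fintype.card_prod]
  unfold Matrix.rank
  omega

end MatMul

end OrbitRankGen

end Summit.MatrixMultiplication.MatrixMultiplication.Theorems
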